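import Summits.PneNP.PneNP.Theorems.SymmetryBudgetWindowCanoniserSoundA

/-!
# Window canoniser, XXV: soundness at section nodes, I — the parts and their data

Route `PneNP/SymmetryBudget`, dichotomy `WindowBarrier` (stmt-PneNP-2145) / `NoHiddenOrder` (stmt-PneNP-14781);
continuation of `…WindowCanoniserSoundA.lean`.  The context of a section node (`WCan.SecCtx`: an OK inner label
whose final state is disconnected, every part certified with a valid ordering `ordK K` whose data are the part
child's bits); agreeing states have the same switched graph (`WCan.StEq.swG_eq`); the section step of a part
child (`WCan.part_step`), so that the child's final colouring orders its part as mine does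
(`WCan.SecCtx.liftLT_child`); hence the semantics of `pbit`, `pcP`, `ppc`, `pcrk` in terms of `ordK`, and the part
vector of `u ∈ U` is `WCan.SecCtx.vecK (Kf u)` (`WCan.SecCtx.pvec_eq`).
-/

-- `Summit.PneNP.PneNP.…` duplicates `PneNP` BY DESIGN (single-problem summit, D-0017 layout).
set_option linter.dupNamespace false

noncomputable section

namespace Summit.PneNP.PneNP.Theorems

namespace WCan

open Finset Literature.Computability.Complexity Literature.Computability.Complexity.CGCanon
  Literature.Combinatorics.SimpleGraph
open scoped Classical

variable {K r n : ℕ}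

/-! ### Agreeing states have the same switched graph -/

omit K r in
/-- The switched graph of a state depends on the colouring only through the kernel of its lift. -/
theorem swG_eq_of_ker {G' : SimpleGraph (Fin n)} {W : Finset (Fin n)} {c c' : Fin n → ℕ}
    (h : ∀ u w, liftCol W c u = liftCol W c w ↔ liftCol W c' u = liftCol W c' w) : swG G' W c = swG G' W c' := by
  ext u v
  simp only [swG, swGraph_adj]
  have hcell : ∀ a, cellCard (liftCol W c) (liftCol W c a) = cellCard (liftCol W c') (liftCol W c' a) := by
    intro a; unfold cellCard; congr 1; ext w; simp only [mem_filter, mem_univ, true_and, h]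
  have hcross : ∀ a b, crossEdges (within G' W) (liftCol W c) (liftCol W c a) (liftCol W c b) =
      crossEdges (within G' W) (liftCol W c') (liftCol W c' a) (liftCol W c' b) := by
    intro a b; unfold crossEdges; congr 1; ext p; simp only [mem_filter, mem_univ, true_and, h]
  simp only [Switch, hcell, hcross]

/-- Agreeing states have the same switched graph. -/
theorem StEq.swG_eq {x : Fin (r + n) × Fin (r + n) → Bool} {S S' : St n} (h : StEq S S') :
    swG (G x) S.W S.c = swG (G x) S'.W S'.c := by
  obtain ⟨W, c, Cc, ar, de⟩ := S
  obtain ⟨W', c', Cc', ar', de'⟩ := S'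
  obtain ⟨hW, -, hlt⟩ := h
  simp only at hW hlt
  subst hW
  apply swG_eq_of_ker
  intro u w
  have e1 := St.not_liftLT_iff (S := ⟨W, c, Cc, ar, de⟩) (u := u) (w := w)
  have e2 := St.not_liftLT_iff (S := ⟨W, c', Cc', ar', de'⟩) (u := u) (w := w)
  simp only at e1 e2
  rw [← e1, ← e2, hlt, hlt]

/-- Hence the same connectivity … -/
theorem StEq.isConn_iff {x : Fin (r + n) × Fin (r + n) → Bool} {S S' : St n} (h : StEq S S') :
    IsConn (G x) S.W S.c ↔ IsConn (G x) S'.W S'.c := by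
  unfold IsConn; rw [h.swG_eq, h.1]

/-- … and the same components. -/
theorem StEq.comp_eq {x : Fin (r + n) × Fin (r + n) → Bool} {S S' : St n} (h : StEq S S') (u : Fin n) :
    comp (G x) S.W S.c u = comp (G x) S'.W S'.c u := by
  unfold comp; rw [h.swG_eq, h.1]

/-! ### The section step of a part child -/

/-- **The section step**: an unfrozen disconnected state whose label's `U` is a component steps to
`(U, c, C)` and does not die. -/
theorem part_step (Lp : RawLab n) (x : Fin (r + n) × Fin (r + n) → Bool) {S : St n} (hf : ¬ frzP Lp S)
    (hnc : ¬ IsConn (G x) S.W S.c) {a : Fin n} (ha : a ∈ S.W) (hU : Lp.U = comp (G x) S.W S.c a) (h2 : ¬ S.W.card ≤ 1) :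
    (step Lp x S).W = Lp.U ∧ (step Lp x S).c = S.c ∧ (step Lp x S).C = S.C ∧ (step Lp x S).dead = S.dead := by
  have hsec : secW Lp x S = Lp.U := by
    ext v
    rw [secW, mem_filter, hU, mem_comp]
    constructor
    · rintro ⟨hv, u, hu, -, huv⟩
      exact ⟨hv, (mem_comp.1 hu).2.trans huv⟩
    · rintro ⟨hv, hav⟩
      exact ⟨hv, a, mem_comp_self ha, ha, hav⟩
  have hpok : pokP Lp x S := by
    refine ⟨fun u hu u' hu' => ?_, ?_⟩
    · rw [hU, mem_comp] at hu hu'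
      exact ⟨hu.1, hu.2.symm.trans hu'.2⟩
    · rw [hU]; exact ⟨a, mem_comp_self ha⟩
  refine ⟨by simp [step, hf, hnc, hsec], by simp [step, hf, hnc], by simp [step, hf, hnc], ?_⟩
  cases hd : S.dead <;> simp [step, hf, hnc, hd, h2, hpok]

/-! ### The context of a section node -/

section Ctx

variable [NeZero n]

/-- The part of `u` in the final state of `L`. -/
abbrev Kf (L : Lab K n) (x : Fin (r + n) × Fin (r + n) → Bool) (u : Fin n) : Finset (Fin n) :=
  comp (G x) (finSt L.1 x).W (finSt L.1 x).c u

/-- **The context of a section node.**  `L` is an OK inner label with disconnected final state; every part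
`Kf u` (`u ∈ U`) is a defined part child, certified through my state, OK, and its value bits are the data of the
valid ordering `ordK (Kf u)`. -/
structure SecCtx (L : Lab K n) (x : Fin (r + n) × Fin (r + n) → Bool) (ordK : Finset (Fin n) → ℕ → Fin n) : Prop where
  /-- inner label -/
  hU : ¬ L.1.U.card ≤ 1
  /-- OK replay -/
  hok : okP L.1 x
  /-- disconnected final state -/
  hnc : ¬ IsConn (G x) (finSt L.1 x).W (finSt L.1 x).c
  /-- the parts are certified and decoded by `ordK` -/
  part : ∀ u ∈ L.1.U, ∃ Lc, partLab L (Kf L x u) = some Lc ∧ thruR L.1 Lc.1 x true u ∧ okP Lc.1 x ∧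
    ValidOrd (Kf L x u) (ordK (Kf L x u)) ∧ ∀ z' b, ev x (aVbit (r := r) Lc z' b) = true ↔ Data Lc.1 x (ordK (Kf L x u)) (bdec b)

namespace SecCtx

variable {L : Lab K n} {x : Fin (r + n) × Fin (r + n) → Bool} {ordK : Finset (Fin n) → ℕ → Fin n} (C : SecCtx L x ordK)
include C

/-- The final vertex set is `U`. -/
theorem hW : (finSt L.1 x).W = L.1.U := (finSt_eq_of_okP L.1 x C.hok).1

/-- Parts lie in `U`. -/
theorem Kf_subset (u : Fin n) : Kf L x u ⊆ L.1.U := fun _ hv => C.hW ▸ (mem_comp.1 hv).1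

/-- A vertex of `U` lies in its part. -/
theorem mem_Kf_self {u : Fin n} (hu : u ∈ L.1.U) : u ∈ Kf L x u := mem_comp_self (C.hW.symm ▸ hu)

omit [NeZero n] C in
/-- Parts are parts of their members. -/
theorem Kf_eq_of_mem {u v : Fin n} (hv : v ∈ Kf L x u) : Kf L x v = Kf L x u := comp_eq_of_mem hv

/-- Parts are proper. -/
theorem Kf_ssubset (u : Fin n) : Kf L x u ⊂ L.1.U := C.hW ▸ comp_ssubset_of_not_isConn C.hnc u

/-- Parts of members of `U` have at most `n` and at least one element. -/
theorem card_Kf_pos {u : Fin n} (hu : u ∈ L.1.U) : 0 < (Kf L x u).card := card_pos.2 ⟨u, C.mem_Kf_self hu⟩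

/-- **`isP` decoded**: `U'` is the part of `u ∈ U`. -/
theorem isPartP_iff (u : Fin n) (U' : Finset (Fin n)) : isPartP (r := r) L x u U' ↔ u ∈ L.1.U ∧ U' = Kf L x u := by
  unfold isPartP
  constructor
  · rintro ⟨hu, -, -, h⟩
    refine ⟨hu, ?_⟩
    ext v
    rw [h v, mem_comp, C.hW]
    exact ⟨fun ⟨_, h2⟩ => ⟨mem_of_reachable hu h2, h2⟩, fun ⟨_, h2⟩ => ⟨hu, h2⟩⟩
  · rintro ⟨hu, rfl⟩
    refine ⟨hu, C.Kf_ssubset u, ⟨u, C.mem_Kf_self hu⟩, fun v => ?_⟩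
    rw [mem_comp, C.hW]
    exact ⟨fun ⟨_, h2⟩ => ⟨hu, h2⟩, fun ⟨_, h2⟩ => ⟨mem_of_reachable hu h2, h2⟩⟩

/-! ### The part child's final state -/

/-- **The final state of a certified part child** is `(K, c', X)` with `c'` ordering `K` as my final colouring
does: for `v, w ∈ K`, the child's lifted order is mine. -/
theorem liftLT_child {u : Fin n} (hu : u ∈ L.1.U) {Lc : Lab K n} (hLc : partLab L (Kf L x u) = some Lc)
    (hthru : thruR L.1 Lc.1 x true u) :
    (finSt Lc.1 x).W = Kf L x u ∧
      ∀ v ∈ Kf L x u, ∀ w ∈ Kf L x u, ((finSt Lc.1 x).liftLT v w ↔ (finSt L.1 x).liftLT v w) := by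
  obtain ⟨hLc1, -, -⟩ := partLab_spec hLc
  obtain ⟨it, hit, hSt, hnf, -⟩ := hthru
  set S' := rs Lc.1 x it with hS'
  have hUc : Lc.1.U = Kf L x u := by rw [hLc1]; rfl
  have hXc : Lc.1.X = L.1.X := by rw [hLc1]; rfl
  have hnc' : ¬ IsConn (G x) S'.W S'.c := by rw [hSt.isConn_iff]; exact C.hnc
  have hKu : Lc.1.U = comp (G x) S'.W S'.c u := by rw [hUc, Kf, hSt.comp_eq]
  have hu' : u ∈ S'.W := by rw [hSt.1, C.hW]; exact hu
  have h2 : ¬ S'.W.card ≤ 1 := by rw [hSt.1, C.hW]; exact C.hU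
  obtain ⟨hW1, hc1, hC1, -⟩ := part_step Lc.1 x hnf hnc' hu' hKu h2
  have hnow : nowP Lc.1 (rs Lc.1 x (it + 1)) := by
    rw [rs_succ]; refine ⟨hW1, ?_⟩; rw [hC1, hSt.2.1, (finSt_eq_of_okP L.1 x C.hok).2, hXc]
  obtain ⟨hWf, hcf, -, -, -⟩ := rs_frozen Lc.1 x (t := it + 1) (t' := T n) (Or.inr (Or.inl hnow)) (by omega)
  have hWfin : (finSt Lc.1 x).W = Kf L x u := by rw [finSt, hWf, rs_succ, hW1, hUc]
  have hcfin : (finSt Lc.1 x).c = S'.c := by rw [finSt, hcf, rs_succ, hc1]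
  refine ⟨hWfin, fun v hv w hw => ?_⟩
  have hvU : v ∈ L.1.U := C.Kf_subset u hv
  have hwU : w ∈ L.1.U := C.Kf_subset u hw
  rw [St.liftLT_of_mem _ (hWfin.symm ▸ hv) (hWfin.symm ▸ hw), hcfin,
    ← St.liftLT_of_mem S' (by rw [hSt.1, C.hW]; exact hvU) (by rw [hSt.1, C.hW]; exact hwU), hSt.2.2]

/-- Hence the child's ranks are my ranks inside the part. -/
theorem rankF_child {u : Fin n} (hu : u ∈ L.1.U) {Lc : Lab K n} (hLc : partLab L (Kf L x u) = some Lc)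
    (hthru : thruR L.1 Lc.1 x true u) {v : Fin n} (hv : v ∈ Kf L x u) : rankF Lc.1 x v = rkIn (r := r) L x (Kf L x u) v := by
  obtain ⟨hWc, hlt⟩ := C.liftLT_child hu hLc hthru
  rw [rankF_eq, rankS, rkIn, hWc]
  congr 1
  exact filter_congr fun w hw => hlt w hw v hv

/-! ### Ranks inside a part -/

/-- Inside a part, equal inner ranks mean equal colours. -/
theorem ceq_of_rkIn_eq {A : Finset (Fin n)} (hA : A ⊆ L.1.U) {v w : Fin n} (hv : v ∈ A) (hw : w ∈ A)
    (h : rkIn (r := r) L x A v = rkIn (r := r) L x A w) : (finSt L.1 x).c v = (finSt L.1 x).c w := by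
  set S := finSt L.1 x
  have hvW : v ∈ S.W := by rw [C.hW]; exact hA hv
  have hwW : w ∈ S.W := by rw [C.hW]; exact hA hw
  have key : ∀ {a b : Fin n}, a ∈ A → a ∈ S.W → b ∈ S.W → S.c a < S.c b → rkIn (r := r) L x A a < rkIn (r := r) L x A b := by
    intro a b haA haW hbW hlt
    unfold rkIn
    apply card_lt_card
    rw [ssubset_iff_of_subset]
    · refine ⟨a, mem_filter.2 ⟨haA, (S.liftLT_of_mem haW hbW).2 hlt⟩, fun h' => liftLT_irrefl S a (mem_filter.1 h').2⟩
    · intro w' hw'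
      rw [mem_filter] at hw' ⊢
      refine ⟨hw'.1, ?_⟩
      have := hw'.2
      rw [St.liftLT_iff] at this ⊢
      exact this.trans ((S.liftLT_iff a b).1 ((S.liftLT_of_mem haW hbW).2 hlt))
  by_contra hne
  rcases lt_or_gt_of_ne hne with hlt | hlt
  · exact absurd h (key hv hvW hwW hlt).ne
  · exact absurd h (key hw hwW hvW hlt).ne'

omit [NeZero n] C in
/-- Inner ranks are below `n` for members. -/
theorem rkIn_lt {A : Finset (Fin n)} {v : Fin n} (hv : v ∈ A) : rkIn (r := r) L x A v < n := by
  unfold rkIn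
  calc (A.filter fun w' => (finSt L.1 x).liftLT w' v).card < A.card :=
        card_lt_card ((filter_ssubset).2 ⟨v, hv, liftLT_irrefl _ v⟩)
    _ ≤ n := (card_le_univ _).trans_eq (by simp)

omit [NeZero n] C in
/-- Equal colours: `EQP` is an equivalence of lifted colours. -/
theorem EQP_iff (a b : Fin n) : EQP (r := r) L x a b ↔
    liftCol (finSt L.1 x).W (finSt L.1 x).c a = liftCol (finSt L.1 x).W (finSt L.1 x).c b := by
  rw [EQP, ← St.not_liftLT_iff]

/-! ### The part data -/

/-- **`pcP` decoded**: position `p` of the part `K = Kf u` carries the colour of `w` iff `p < |K|` and the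
vertex `ordK K p` has the colour of `w`. -/
theorem pcPP_iff {u : Fin n} (hu : u ∈ L.1.U) (p w : Fin n) :
    pcPP (r := r) L x (Kf L x u) p w ↔ (p : ℕ) < (Kf L x u).card ∧ EQP (r := r) L x (ordK (Kf L x u) p) w := by
  obtain ⟨Lc, hLc, hthru, hokc, hvalid, hdata⟩ := C.part u hu
  obtain ⟨hLc1, -, -⟩ := partLab_spec hLc
  have hUc : Lc.1.U = Kf L x u := by rw [hLc1]; rfl
  unfold pcPP
  simp only [hLc, Option.some.injEq, exists_eq_left', hdata, bdec_benc, Data, hUc]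
  constructor
  · rintro ⟨w'', hw'', j, ⟨hp, hr⟩, hrk, heq⟩
    refine ⟨hp, ?_⟩
    have hop : ordK (Kf L x u) p ∈ Kf L x u := hvalid.1 p hp
    rw [C.rankF_child hu hLc hthru hop] at hr
    have hce := C.ceq_of_rkIn_eq (C.Kf_subset u) hw'' hop (by rw [hrk, hr])
    rw [EQP_iff] at heq ⊢
    rw [← heq, liftCol_of_mem _ (by rw [C.hW]; exact C.Kf_subset u hop), liftCol_of_mem _ (by rw [C.hW]; exact C.Kf_subset u hw''), hce]
  · rintro ⟨hp, heq⟩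
    have hop : ordK (Kf L x u) p ∈ Kf L x u := hvalid.1 p hp
    refine ⟨ordK (Kf L x u) p, hop, ⟨rkIn (r := r) L x (Kf L x u) (ordK (Kf L x u) p), rkIn_lt hop⟩, ⟨hp, ?_⟩, rfl, heq⟩
    exact C.rankF_child hu hLc hthru hop

/-- **`ppc` decoded.** -/
theorem ppc_iff {u : Fin n} (hu : u ∈ L.1.U) (p w : Fin n) (hn : 2 ≤ n) :
    ev x (aPpc (r := r) L u p w) = true ↔ (p : ℕ) < (Kf L x u).card ∧ EQP (r := r) L x (ordK (Kf L x u) p) w := by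
  rw [ev_aPpc hn, decide_eq_true_iff]
  simp only [C.isPartP_iff, hu, true_and, exists_eq_left, C.pcPP_iff hu]

/-- **`pcrk` decoded**: the colour at position `p` of the part of `u` has rank `j` in my final colouring. -/
theorem pcrk_iff {u : Fin n} (hu : u ∈ L.1.U) (p j : Fin n) (hn : 2 ≤ n) :
    ev x (aPcrk (r := r) L u p j) = true ↔ (p : ℕ) < (Kf L x u).card ∧ rankF L.1 x (ordK (Kf L x u) p) = j := by
  rw [ev_aPcrk hn, decide_eq_true_iff]
  simp only [C.ppc_iff hu _ _ hn]
  constructor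
  · rintro ⟨w, ⟨hp, heq⟩, hj⟩
    refine ⟨hp, ?_⟩
    rw [← hj, rankF_eq, rankF_eq]
    exact rankS_eq_of_not_lt _ heq.1 heq.2
  · rintro ⟨hp, hj⟩
    exact ⟨_, ⟨hp, liftLT_irrefl _ _, liftLT_irrefl _ _⟩, hj⟩

/-- **`pbit` decoded.** -/
theorem pbitP_iff {u : Fin n} (hu : u ∈ L.1.U) (i : Fin (NBp r n)) :
    pbitP (r := r) L x u i ↔
      match bpdec i with
      | Sum.inl s => (Kf L x u).card = (s : ℕ)
      | Sum.inr b => ∃ Lc, partLab L (Kf L x u) = some Lc ∧ Data Lc.1 x (ordK (Kf L x u)) (bdec b) := by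
  obtain ⟨Lc, hLc, -, -, -, hdata⟩ := C.part u hu
  unfold pbitP
  simp only [C.isPartP_iff, hu, true_and, exists_eq_left]
  rcases bpdec i with s | b
  · rfl
  · simp only [hLc, Option.some.injEq, exists_eq_left', hdata]

/-- **The part data** of a part `K'` under `ordK K'`: size in one-hot, adjacency and outside bits of the
ordering, colour ranks in MY final colouring. -/
def PV (K' : Finset (Fin n)) : Fin (NBp r n) → Prop := fun i =>
  match bpdec i with
  | Sum.inl s => K'.card = (s : ℕ)
  | Sum.inr b =>
    match bdec b with
    | .adj p q => (p : ℕ) < K'.card ∧ (q : ℕ) < K'.card ∧ (G x).Adj (ordK K' p) (ordK K' q)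
    | .ext p o => (p : ℕ) < K'.card ∧ xo x (ordK K' p) o = true
    | .crk p j => (p : ℕ) < K'.card ∧ rankF L.1 x (ordK K' p) = j

omit [NeZero n] C in
/-- The part vector as a Boolean tuple. -/
def vecK (K' : Finset (Fin n)) : Fin (NBp r n) → Bool := fun i => decide (PV (L := L) (x := x) (ordK := ordK) K' i)

/-- **The part vector of `u ∈ U` is the part data of its part.** -/
theorem pvec_eq {u : Fin n} (hu : u ∈ L.1.U) (hn : 2 ≤ n) : pvec L x u = vecK (L := L) (x := x) (ordK := ordK) (Kf L x u) := by
  obtain ⟨Lc, hLc, -, -, -, -⟩ := C.part u hu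
  obtain ⟨hLc1, -, -⟩ := partLab_spec hLc
  have hUc : Lc.1.U = Kf L x u := by rw [hLc1]; rfl
  funext i
  unfold pvec vecK pvecA PV
  apply Bool.eq_iff_iff.2
  rw [decide_eq_true_iff]
  rcases hi : bpdec i with s | b
  · rw [ev_aPbit hn, decide_eq_true_iff, C.pbitP_iff hu, hi]
  · rcases hb : bdec b with ⟨p, q⟩ | ⟨p, o⟩ | ⟨p, j⟩
    · simp only [hb]
      rw [ev_aPbit hn, decide_eq_true_iff, C.pbitP_iff hu, hi]
      simp only [hLc, Option.some.injEq, exists_eq_left', hb, Data, hUc]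
    · simp only [hb]
      rw [ev_aPbit hn, decide_eq_true_iff, C.pbitP_iff hu, hi]
      simp only [hLc, Option.some.injEq, exists_eq_left', hb, Data, hUc]
    · simp only [hb]
      exact C.pcrk_iff hu p j hn

end SecCtx

end Ctx

end WCan

end Summit.PneNP.PneNP.Theorems

end
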